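import Mathlib
import Summits.AtomisticToContinuum.HydrodynamicLimit.Theorems.ImplosionDichotomyDenseExcursionPackingAnalyticSonicEulerComplex
import Summits.AtomisticToContinuum.HydrodynamicLimit.Theorems.ImplosionDichotomyDenseExcursionPackingAnalyticSonicEulerUnique
import Summits.AtomisticToContinuum.HydrodynamicLimit.Theorems.ImplosionDichotomyDenseExcursionPackingAnalyticSonicComplexTransport

/-!
# The two ray estimates of the complex sonic window: the Euler a-priori sup bound and weighted transport along a segment
# (crux `DenseExcursion`, stmt-AtomisticToContinuum-12586, line `sonic-cavity-renewal` v9, stub `stub_analyticPackingImplosion`)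

Helper file (`--supports stmt-AtomisticToContinuum-12586`, line lead a2, wave-5 worker D2, task `sonicWindow_analytic_bound`,
worker reports `work/stubs/D1_gammaClosure.REPORT.md` §3.2–3.3 and `D2_triangle.REPORT.md`). The two scalar kernel estimates of
the sup-norm window plan, in the A-PRIORI form in which both the existence iteration and the final bound consume them:

* `eulerHolomorphic_apriori_bound` (REGISTERED helper): ANY holomorphic solution `Y` of `z Y′ + a Y = H` (`a > 0`) on an open
  set star-convex with respect to `0` obeys `‖Y z‖ ≤ M/a` whenever `‖H(σ z)‖ ≤ M` on the ray `σ ∈ [0, 1]` — the landed explicit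
  resolvent `eulerResolvent_holomorphic_bound` plus UNIQUENESS of holomorphic solutions (the difference `Q` solves
  `z Q′ + a Q = 0`; along the ray `t ↦ Q(tz)` the real and imaginary parts solve the real Euler equation and are continuous at
  `t = 0`, hence vanish by `euler_homogeneous_pos`);
* `rayTransport_weighted_bound` (REGISTERED helper): if `M′ = g M + F` (complex derivative) along the segment
  `t ↦ p + t v`, `t ∈ [0, 1]`, with `β₀ ≤ K‖v‖ + Re(−v g)` and `e^{−Kt‖v‖}‖F‖ ≤ Φ` on it, then
  `e^{−K‖v‖}‖M(p + v)‖ ≤ ‖M p‖ e^{−β₀} + ‖v‖Φ/β₀` — the landed `complexDampedTransport_apriori_bound` after the substitution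
  `m̂(t) = e^{−Kt‖v‖} M(p + tv)` (with `K = 0`: the damped slanted rays of the window estimate; with `K ≍ Λ`: the weighted
  norm in which the existence iteration contracts even in the anti-damped direction).

Sources: Coddington–Levinson 1955 Ch. 4 §2; standard. NOT here: the profile, the triangle, or `Γ`.
-/

noncomputable section

open Set Metric Filter Topology

namespace Summit.AtomisticToContinuum.HydrodynamicLimit.Theorems.PackingAnalyticImplosion

/-! ## Uniqueness and the a-priori bound for the holomorphic Euler equation -/

/-- A holomorphic solution of the HOMOGENEOUS Euler equation `z Q′ + a Q = 0`, `a > 0`, on an open set star-convex with respect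
to `0` vanishes identically. [folklore] -/
theorem eulerHolomorphic_homogeneous_eq_zero {a : ℝ} {U : Set ℂ} {Q : ℂ → ℂ} (ha : 0 < a) (hU : IsOpen U)
    (hst : StarConvex ℝ (0 : ℂ) U) (hQ : DifferentiableOn ℂ Q U) (heq : ∀ z ∈ U, z * deriv Q z + a * Q z = 0) :
    ∀ z ∈ U, Q z = 0 := by
  intro z hz
  have h0 : (0 : ℂ) ∈ U := hst.mem ⟨z, hz⟩
  -- rays `t z`, `t ∈ [0, 1]`, and a little beyond
  obtain ⟨ε, hε, hballz⟩ := Metric.isOpen_iff.1 hU z hz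
  set ρ' : ℝ := 1 + ε / (‖z‖ + 1) with hρ'
  have hz1 : 0 < ‖z‖ + 1 := by positivity
  have hρ'1 : 1 < ρ' := by simp only [hρ']; linarith [div_pos hε hz1]
  have hmem : ∀ t ∈ Ioo (0 : ℝ) ρ', (t : ℂ) * z ∈ U := by
    intro t ht
    rcases le_or_gt t 1 with h1 | h1
    · have h := hst hz (sub_nonneg.2 h1) ht.1.le (sub_add_cancel 1 t)
      simpa [Complex.real_smul] using h
    · apply hballz
      rw [mem_ball, dist_eq_norm]
      have e1 : (t : ℂ) * z - z = ((t - 1 : ℝ) : ℂ) * z := by push_cast; ring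
      rw [e1, norm_mul, Complex.norm_real, Real.norm_eq_abs, abs_of_pos (by linarith)]
      have ht2 : t - 1 < ε / (‖z‖ + 1) := by simp only [hρ'] at ht; linarith [ht.2]
      calc (t - 1) * ‖z‖ ≤ ε / (‖z‖ + 1) * ‖z‖ := mul_le_mul_of_nonneg_right ht2.le (norm_nonneg z)
        _ < ε / (‖z‖ + 1) * (‖z‖ + 1) := mul_lt_mul_of_pos_left (by linarith) (div_pos hε hz1)
        _ = ε := div_mul_cancel₀ ε hz1.ne'
  -- the restriction `q t = Q (t z)` and its derivative
  set q : ℝ → ℂ := fun t => Q ((t : ℂ) * z) with hq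
  have hqd : ∀ t ∈ Ioo (0 : ℝ) ρ', HasDerivAt q (deriv Q ((t : ℂ) * z) * z) t := by
    intro t ht
    have h1 : HasDerivAt Q (deriv Q ((t : ℂ) * z)) ((t : ℂ) * z) :=
      (hQ.differentiableAt (hU.mem_nhds (hmem t ht))).hasDerivAt
    have h2 : HasDerivAt (fun w : ℂ => Q (w * z)) (deriv Q ((t : ℂ) * z) * z) (t : ℂ) := by
      have h3 : HasDerivAt (fun w : ℂ => w * z) z (t : ℂ) := by simpa using (hasDerivAt_id (t : ℂ)).mul_const z
      exact h1.comp (t : ℂ) h3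
    exact h2.comp_ofReal
  have hqeq : ∀ t ∈ Ioo (0 : ℝ) ρ', (t : ℂ) * deriv q t + a * q t = 0 := by
    intro t ht
    rw [(hqd t ht).deriv]
    have h := heq _ (hmem t ht)
    simp only [hq]
    linear_combination h
  -- continuity at `t = 0`
  have hqc : ContinuousAt q 0 := by
    have h1 : ContinuousAt Q ((0 : ℝ) * z) := by
      simpa using (hQ.differentiableAt (hU.mem_nhds (by simpa using h0))).continuousAt
    have h2 : Continuous (fun t : ℝ => (t : ℂ) * z) := by fun_prop
    exact ContinuousAt.comp (f := fun t : ℝ => (t : ℂ) * z) (x := 0) (by simpa using h1) h2.continuousAt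
  -- real and imaginary parts solve the real Euler equation
  have hre : ∀ t ∈ Ioo (0 : ℝ) ρ', (q t).re = 0 := by
    refine euler_homogeneous_pos (q := fun t => (q t).re) ha ?_ ?_ ?_
    · intro t ht
      exact ((Complex.reCLM.hasFDerivAt.comp_hasDerivAt t (hqd t ht)).differentiableAt).differentiableWithinAt
    · exact (Complex.continuous_re.continuousAt.comp hqc).continuousWithinAt
    · intro t ht
      have hd1 : HasDerivAt (fun s => (q s).re) ((deriv Q ((t : ℂ) * z) * z).re) t :=
        (Complex.reCLM.hasFDerivAt.comp_hasDerivAt t (hqd t ht)).congr_deriv (Complex.reCLM_apply _)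
      rw [hd1.deriv]
      have h := congrArg Complex.re (hqeq t ht)
      rw [(hqd t ht).deriv] at h
      simpa using h
  have him : ∀ t ∈ Ioo (0 : ℝ) ρ', (q t).im = 0 := by
    refine euler_homogeneous_pos (q := fun t => (q t).im) ha ?_ ?_ ?_
    · intro t ht
      exact ((Complex.imCLM.hasFDerivAt.comp_hasDerivAt t (hqd t ht)).differentiableAt).differentiableWithinAt
    · exact (Complex.continuous_im.continuousAt.comp hqc).continuousWithinAt
    · intro t ht
      have hd1 : HasDerivAt (fun s => (q s).im) ((deriv Q ((t : ℂ) * z) * z).im) t :=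
        (Complex.imCLM.hasFDerivAt.comp_hasDerivAt t (hqd t ht)).congr_deriv (Complex.imCLM_apply _)
      rw [hd1.deriv]
      have h := congrArg Complex.im (hqeq t ht)
      rw [(hqd t ht).deriv] at h
      simpa using h
  have h1mem : (1 : ℝ) ∈ Ioo (0 : ℝ) ρ' := ⟨one_pos, hρ'1⟩
  have hq1 : q 1 = 0 := Complex.ext (by simpa using hre 1 h1mem) (by simpa using him 1 h1mem)
  simpa [hq] using hq1

/-- **THE EULER A-PRIORI SUP BOUND** (registered helper `eulerHolomorphic_apriori_bound` of `stub_analyticPackingImplosion`):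
any holomorphic solution `Y` of `z Y′ + a Y = H`, `a > 0`, on an open set star-convex with respect to `0` satisfies
`‖Y z‖ ≤ M/a` as soon as `‖H(σ z)‖ ≤ M` for `σ ∈ [0, 1]`. [folklore] -/
theorem eulerHolomorphic_apriori_bound : ∀ (a : ℝ) (U : Set ℂ) (Y H : ℂ → ℂ), 0 < a → IsOpen U → StarConvex ℝ (0 : ℂ) U → DifferentiableOn ℂ Y U → (∀ z ∈ U, z * deriv Y z + a * Y z = H z) → ∀ z ∈ U, ∀ M : ℝ, (∀ σ ∈ Set.Icc (0 : ℝ) 1, ‖H ((σ : ℂ) * z)‖ ≤ M) → ‖Y z‖ ≤ M / a := by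
  intro a U Y H ha hU hst hY heq z hz M hM
  -- `H` is holomorphic on `U`
  have hY' : DifferentiableOn ℂ (deriv Y) U := ((hY.analyticOnNhd hU).deriv).differentiableOn
  have hH : DifferentiableOn ℂ H U := by
    have h1 : DifferentiableOn ℂ (fun z => z * deriv Y z + a * Y z) U :=
      (differentiableOn_id.mul hY').add (hY.const_mul _)
    exact h1.congr fun w hw => (heq w hw).symm
  obtain ⟨Ys, hYs, hYseq, hYsb⟩ := eulerResolvent_holomorphic_bound a U H ha hU hst hH
  -- the difference solves the homogeneous equation, hence vanishes
  have hQ : ∀ w ∈ U, (Y w - Ys w) = 0 := by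
    refine eulerHolomorphic_homogeneous_eq_zero ha hU hst (hY.sub hYs) fun w hw => ?_
    have hd : deriv (fun w => Y w - Ys w) w = deriv Y w - deriv Ys w :=
      deriv_fun_sub (hY.differentiableAt (hU.mem_nhds hw)) (hYs.differentiableAt (hU.mem_nhds hw))
    rw [hd]
    linear_combination heq w hw - hYseq w hw
  have hYeq : Y z = Ys z := sub_eq_zero.1 (hQ z hz)
  rw [hYeq]
  exact hYsb z hz M hM

/-! ## Weighted damped transport along a complex segment -/

/-- **WEIGHTED TRANSPORT ALONG A SEGMENT** (registered helper `rayTransport_weighted_bound` of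
`stub_analyticPackingImplosion`): if `M` has complex derivative `g M + F` at the points `p + t v`, `t ∈ [0, 1]`, of a segment,
with `β₀ ≤ K‖v‖ + Re(−v·g)` (`β₀ > 0`) and `e^{−Kt‖v‖}‖F‖ ≤ Φ` along it, then
`e^{−K‖v‖}‖M(p + v)‖ ≤ ‖M p‖e^{−β₀} + ‖v‖Φ/β₀`. [folklore] -/
theorem rayTransport_weighted_bound : ∀ (g F M : ℂ → ℂ) (p v : ℂ) (K β₀ Φ : ℝ), 0 < β₀ → (∀ t ∈ Set.Icc (0 : ℝ) 1, HasDerivAt M (g (p + (t : ℂ) * v) * M (p + (t : ℂ) * v) + F (p + (t : ℂ) * v)) (p + (t : ℂ) * v)) → (∀ t ∈ Set.Icc (0 : ℝ) 1, β₀ ≤ K * ‖v‖ + (-(v * g (p + (t : ℂ) * v))).re) → (∀ t ∈ Set.Icc (0 : ℝ) 1, Real.exp (-(K * t * ‖v‖)) * ‖F (p + (t : ℂ) * v)‖ ≤ Φ) → Real.exp (-(K * ‖v‖)) * ‖M (p + v)‖ ≤ ‖M p‖ * Real.exp (-β₀) + ‖v‖ * Φ / β₀ := by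
  intro g F M p v K β₀ Φ hβ₀ hM hB hF
  -- the weighted amplitude along the segment
  set γ : ℝ → ℂ := fun t => p + (t : ℂ) * v with hγ
  set w : ℝ → ℝ := fun t => Real.exp (-(K * t * ‖v‖)) with hw
  set m : ℝ → ℂ := fun t => (w t : ℂ) * M (γ t) with hm
  set B : ℝ → ℂ := fun t => ((K * ‖v‖ : ℝ) : ℂ) - v * g (γ t) with hBdef
  set Fo : ℝ → ℂ := fun t => (w t : ℂ) * (v * F (γ t)) with hFo
  have hγd : ∀ t, HasDerivAt γ v t := fun t => by
    have h : HasDerivAt (fun s : ℝ => (s : ℂ)) 1 t := Complex.ofRealCLM.hasDerivAt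
    simpa [hγ] using (h.mul_const v).const_add p
  have hwd : ∀ t, HasDerivAt w (-(K * ‖v‖) * w t) t := fun t => by
    have e1 : (fun s : ℝ => -(K * s * ‖v‖)) = fun y : ℝ => -(K * ‖v‖) * y := by
      funext y; ring
    have h1 : HasDerivAt (fun s : ℝ => -(K * s * ‖v‖)) (-(K * ‖v‖)) t := by
      rw [e1]
      simpa using (hasDerivAt_id t).const_mul (-(K * ‖v‖))
    have h2 := (Real.hasDerivAt_exp _).comp t h1
    simp only [hw]
    exact h2.congr_deriv (by ring)
  have hmd : ∀ t ∈ Icc (0 : ℝ) 1, HasDerivAt m (-B t * m t + Fo t) t := by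
    intro t ht
    have h1 : HasDerivAt (fun s : ℝ => M (γ s)) (v * (g (γ t) * M (γ t) + F (γ t))) t := by
      have := (hM t ht).scomp t (hγd t)
      exact this.congr_deriv (by rw [smul_eq_mul])
    have h2 : HasDerivAt (fun s : ℝ => (w s : ℂ)) (((-(K * ‖v‖) * w t : ℝ) : ℂ)) t := (hwd t).ofReal_comp
    have h3 := h2.mul h1
    refine h3.congr_deriv ?_
    simp only [hm, hBdef, hFo]
    push_cast
    ring
  have hBre : ∀ t ∈ Icc (0 : ℝ) 1, β₀ ≤ (B t).re := by
    intro t ht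
    have h := hB t ht
    simp only [hBdef, Complex.sub_re, Complex.ofReal_re, Complex.neg_re] at h ⊢
    linarith
  have hΦ0 : 0 ≤ Φ := le_trans (by positivity) (hF 0 ⟨le_rfl, zero_le_one⟩)
  have hFo_le : ∀ t ∈ Icc (0 : ℝ) 1, ‖Fo t‖ ≤ ‖v‖ * Φ := by
    intro t ht
    have hwpos : 0 < w t := Real.exp_pos _
    simp only [hFo]
    rw [norm_mul, norm_mul, Complex.norm_real, Real.norm_eq_abs, abs_of_pos hwpos]
    have h := hF t ht
    calc w t * (‖v‖ * ‖F (γ t)‖) = ‖v‖ * (Real.exp (-(K * t * ‖v‖)) * ‖F (p + (t : ℂ) * v)‖) := by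
          simp only [hw, hγ]; ring
      _ ≤ ‖v‖ * Φ := mul_le_mul_of_nonneg_left h (norm_nonneg v)
  have key := complexDampedTransport_apriori_bound B Fo m 0 1 β₀ (‖v‖ * Φ) zero_le_one hβ₀ hBre hFo_le hmd 1
    ⟨zero_le_one, le_rfl⟩
  have hm0 : m 0 = M p := by simp [hm, hw, hγ]
  have hm1 : ‖m 1‖ = Real.exp (-(K * ‖v‖)) * ‖M (p + v)‖ := by
    simp only [hm, hw, hγ]
    rw [norm_mul, Complex.norm_real, Real.norm_eq_abs, abs_of_pos (Real.exp_pos _)]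
    simp
  rw [hm1, hm0] at key
  simpa [mul_div_assoc] using key

end Summit.AtomisticToContinuum.HydrodynamicLimit.Theorems.PackingAnalyticImplosion

end
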